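import Mathlib
import Literature.Analysis.FluidPDE.IsometryInvariance
import Literature.Analysis.FluidPDE.AxisymmetricVorticityTransport
import Summits.NavierStokesRegularity.NavierStokesRegularity.Theorems.EulerZoomLiouvillePowerGaugeEulerLiouvillePressureSlavingUniqueness
import Summits.NavierStokesRegularity.NavierStokesRegularity.Theorems.EulerZoomLiouvillePowerGaugeEulerLiouvilleSelfSimilarPressureSlaving
import HarnessLib

/-!
# Crux E `PowerGaugeEulerLiouville` (stmt-NavierStokesRegularity-19832): ISOMETRY SLAVING — in Seregin's class the pressure inherits every
# LINEAR ISOMETRY of the velocity (a.e.); distributional Euler / Navier–Stokes solutions are covariant under linear isometries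
# (lane «pressure slaving», weak chapter; width seat ns-ezl-w3 g3)

Route `EulerZoomLiouville` (NavierStokesRegularity), crux E; LEAD ns-typeII-p2 g12.  Sequel of `…PressureSlavingUniqueness` (p635131: two class pressures of
ONE velocity agree a.e.; the pressure inherits every slab-preserving Euler RESCALING of the velocity) and of the classical chapter `…PressureSymmetry`.
Here the symmetry group is the orthogonal group `R : E ≃ₗᵢ[ℝ] E` acting by `(s, x) ↦ (s, R x)`:

* COVARIANCE (weak form, general finite-dimensional inner-product space `E`, any viscosity, any open time set `S`):
  `PressureSlaving.isDistributional_conj_isometry` — if `(u, p)` is a distributional (pressure-explicit) solution with force `f` on the slab `S × E`,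
  so is the conjugated triple `(s, x) ↦ R (u s (R⁻¹ x))`, `p s (R⁻¹ x)`, `R (f s (R⁻¹ x))` (test fields pull back along `(s, y) ↦ (s, R y)` — which
  preserves Lebesgue measure and the slab — as `ψ'(s, y) = R⁻¹ ψ(s, R y)`; every term of CKN (2.1)–(2.2) is covariant pointwise by the chain rules of
  `Literature.Analysis.FluidPDE.IsometryInvariance`).  The weak twin of `IsClassicalNSSolutionOn.conj_linearIsometryEquiv` (Majda–Bertozzi Prop. 1.1 (iii)).
* SLAVING: `PressureSlaving.pressure_comp_isometry_ae_eq` — a distributional Euler pair on `(−∞,0) × ℝ³` with the `D`-type growth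
  `∫∫_{Q_a(0)}|p|^{3/2} ≤ K a^m` (`m < 3`; class members: `m = 2 − 2ρ`) whose velocity is `R`-EQUIVARIANT on the slab, `u(s, R y) = R u(s, y)`, has
  `R`-INVARIANT pressure a.e.: `p(s, R y) = p(s, y)` for a.e. `(s, y)` (the conjugated pair is a second pressure of the same velocity with the same growth —
  `Q_a(0)` is `R`-invariant — then `PressureSlaving.pressure_ae_unique`).  Member form `PressureSlaving.pressure_comp_isometry_ae_eq_of_gauge` (crux binders
  verbatim, every `ρ > −½`) and the axisymmetric instance `PressureSlaving.pressure_rotZ_ae_eq_of_gauge`: a class member with axisymmetric velocity slices has,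
  for every angle `θ`, `p(s, R_θ y) = p(s, y)` a.e. — with NO hypothesis on `p` (weak class: mirror / discrete-rotation / axisymmetric members alike).

WHAT THIS IS NOT: not NS regularity, not the crux E — structural lemmas on the crux CLASS 19832 (MODEL lattice; E/NS strata) `--supports` stmt-19832.
[folklore; MajdaBertozziCUP2002 §1.2 Prop. 1.1 (iii); KNSS2009 §1; CaffarelliKohnNirenberg1982 §2 (2.1)–(2.2); RusinSverak2011 §2 p. 4]
-/

noncomputable section

-- flat `Theorems/<Route><Decl>…` files of one crux share the namespace of the crux (tree convention: `Summit.<S>.<S>.…`)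
set_option linter.dupNamespace false

open MeasureTheory Set Filter Topology Metric Function TopologicalSpace
open scoped NNReal InnerProductSpace RealInnerProductSpace Laplacian ContDiff

namespace Summit.NavierStokesRegularity.NavierStokesRegularity.Theorems.PowerGaugeEulerLiouville

open Literature.Analysis Literature.Analysis.FunctionSpaces Literature.Analysis.FluidPDE

namespace PressureSlaving

section Covariance

variable {E : Type*} [NormedAddCommGroup E] [InnerProductSpace ℝ E] [FiniteDimensional ℝ E]
  [MeasurableSpace E] [BorelSpace E]
variable {F : Type*} [NormedAddCommGroup F] [NormedSpace ℝ F]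

/-! ### The space–time isometry `(s, x) ↦ (s, R x)` -/

omit [FiniteDimensional ℝ E] [MeasurableSpace E] [BorelSpace E] in
/-- `(s, x) ↦ (s, R x)` is the homeomorphism `refl × R`. [folklore] -/
theorem coe_prodCongr_isometry (R : E ≃ₗᵢ[ℝ] E) :
    ⇑((Homeomorph.refl ℝ).prodCongr R.toHomeomorph) = fun z : ℝ × E => (z.1, R z.2) := by
  funext z
  rfl

/-- `(s, x) ↦ (s, R x)` preserves Lebesgue measure on `ℝ × E`. [folklore] -/
theorem measurePreserving_prod_isometry (R : E ≃ₗᵢ[ℝ] E) :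
    MeasurePreserving (fun z : ℝ × E => (z.1, R z.2)) volume volume := by
  have h := (MeasurePreserving.id (volume : Measure ℝ)).prod R.measurePreserving
  rw [← Measure.volume_eq_prod] at h
  exact h

omit [FiniteDimensional ℝ E] in
/-- `(s, x) ↦ (s, R x)` is a measurable embedding. [folklore] -/
theorem measurableEmbedding_prod_isometry (R : E ≃ₗᵢ[ℝ] E) :
    MeasurableEmbedding (fun z : ℝ × E => (z.1, R z.2)) := by
  rw [← coe_prodCongr_isometry]
  exact ((Homeomorph.refl ℝ).prodCongr R.toHomeomorph).measurableEmbedding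

omit [FiniteDimensional ℝ E] [MeasurableSpace E] [BorelSpace E] in
/-- A slab `S × E` is invariant: its preimage under `(s, x) ↦ (s, R x)` is itself. [folklore] -/
theorem preimage_prod_isometry_slab (R : E ≃ₗᵢ[ℝ] E) (S : Set ℝ) :
    (fun z : ℝ × E => (z.1, R z.2)) ⁻¹' (S ×ˢ (univ : Set E)) = S ×ˢ (univ : Set E) := by
  ext z
  simp [mem_prod]

/-- Change of variables over a slab: `∫_{S×E} G(s, R x) = ∫_{S×E} G`. [folklore] -/
theorem setIntegral_slab_comp_prod_isometry (R : E ≃ₗᵢ[ℝ] E) (S : Set ℝ) (G : ℝ × E → ℝ) :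
    ∫ z in S ×ˢ (univ : Set E), G (z.1, R z.2) = ∫ z in S ×ˢ (univ : Set E), G z := by
  have h := (measurePreserving_prod_isometry R).setIntegral_preimage_emb (measurableEmbedding_prod_isometry R) G
    (S ×ˢ (univ : Set E))
  rwa [preimage_prod_isometry_slab] at h

/-! ### Pointwise chain rules in the form `y ↦ R⁻¹ φ(R y)` (instances of `Literature…IsometryInvariance` at `R⁻¹`) -/

omit [FiniteDimensional ℝ E] [MeasurableSpace E] [BorelSpace E] in
/-- `D(R⁻¹ ∘ φ ∘ R)(y) v = R⁻¹ (Dφ(R y) (R v))`. [folklore] -/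
theorem fderiv_symm_conj_apply (R : E ≃ₗᵢ[ℝ] E) (φ : E → E) (y v : E) :
    fderiv ℝ (fun y => R.symm (φ (R y))) y v = R.symm (fderiv ℝ φ (R y) (R v)) := by
  have h := fderiv_conj_linearIsometryEquiv R.symm φ y
  simp only [LinearIsometryEquiv.symm_symm] at h
  rw [h]
  rfl

omit [MeasurableSpace E] [BorelSpace E] in
/-- `div (R⁻¹ ∘ φ ∘ R)(y) = div φ (R y)`. [folklore] -/
theorem divergence_symm_conj (R : E ≃ₗᵢ[ℝ] E) (φ : E → E) (y : E) :
    VectorCalculus.divergence (fun y => R.symm (φ (R y))) y = VectorCalculus.divergence φ (R y) := by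
  have h := divergence_conj_linearIsometryEquiv R.symm φ y
  simpa only [LinearIsometryEquiv.symm_symm] using h

omit [MeasurableSpace E] [BorelSpace E] in
/-- `Δ (R⁻¹ ∘ φ ∘ R)(y) = R⁻¹ (Δ φ (R y))`. [folklore] -/
theorem laplacian_symm_conj (R : E ≃ₗᵢ[ℝ] E) (φ : E → E) (y : E) :
    (Δ (fun y => R.symm (φ (R y)))) y = R.symm ((Δ φ) (R y)) := by
  have h := laplacian_conj_linearIsometryEquiv R.symm φ y
  simpa only [LinearIsometryEquiv.symm_symm] using h

omit [FiniteDimensional ℝ E] [MeasurableSpace E] [BorelSpace E] in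
/-- `∇(θ ∘ R)(y) = R⁻¹ (∇θ (R y))`. [folklore] -/
theorem gradient_comp_isometry [CompleteSpace E] (R : E ≃ₗᵢ[ℝ] E) (θ : E → ℝ) (y : E) :
    gradient (fun y => θ (R y)) y = R.symm (gradient θ (R y)) := by
  have h := gradient_comp_linearIsometryEquiv_symm R.symm θ y
  simpa only [LinearIsometryEquiv.symm_symm] using h

omit [FiniteDimensional ℝ E] [MeasurableSpace E] [BorelSpace E] in
/-- `∂ₜ (R⁻¹ ψ(·, R y))(s) = R⁻¹ ∂ₜψ(s, R y)` (a continuous linear equivalence commutes with `deriv`). [folklore] -/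
theorem timeDeriv_symm_conj (R : E ≃ₗᵢ[ℝ] E) (ψ : ℝ → E → E) (s : ℝ) (y : E) :
    timeDeriv (fun s y => R.symm (ψ s (R y))) s y = R.symm (timeDeriv ψ s (R y)) := by
  simp only [timeDeriv]
  rw [← fderiv_apply_one_eq_deriv, ← fderiv_apply_one_eq_deriv,
    show (fun t : ℝ => R.symm (ψ t (R y))) = R.symm ∘ (fun t : ℝ => ψ t (R y)) from rfl,
    R.symm.comp_fderiv]
  rfl

/-! ### Test fields and local integrability under `(s, y) ↦ (s, R y)` -/

omit [FiniteDimensional ℝ E] [MeasurableSpace E] [BorelSpace E] in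
/-- Pull-back of space–time test fields on a slab along `(s, y) ↦ (s, R y)`: `ψ(s, R y)` is again a test field on the slab. [folklore] -/
theorem isSpaceTimeTestOn_comp_isometry {S : Set ℝ} (hS : IsOpen S) {ψ : ℝ → E → F}
    (hψ : IsSpaceTimeTestOn (slab E S hS) ψ) (R : E ≃ₗᵢ[ℝ] E) :
    IsSpaceTimeTestOn (slab E S hS) (fun s y => ψ s (R y)) := by
  have hrepr : uncurry (fun s y => ψ s (R y)) = uncurry ψ ∘ (fun z : ℝ × E => (z.1, R z.2)) := by
    funext z; rfl
  change IsTestFunctionOn _ (uncurry fun s y => ψ s (R y))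
  rw [hrepr]
  have hΘ : ContDiff ℝ (⊤ : ℕ∞) (fun z : ℝ × E => (z.1, R z.2)) :=
    contDiff_fst.prodMk (R.toContinuousLinearEquiv.contDiff.comp contDiff_snd)
  refine ⟨hψ.contDiff.comp hΘ, ?_, ?_⟩
  · have h := hψ.hasCompactSupport.comp_homeomorph ((Homeomorph.refl ℝ).prodCongr R.toHomeomorph)
    rwa [coe_prodCongr_isometry] at h
  · intro z hz
    have hcont : Continuous (fun z : ℝ × E => (z.1, R z.2)) := hΘ.continuous
    have h1 : tsupport (uncurry ψ ∘ fun z : ℝ × E => (z.1, R z.2)) ⊆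
        (fun z : ℝ × E => (z.1, R z.2)) ⁻¹' tsupport (uncurry ψ) := by
      rw [tsupport, Function.support_comp_eq_preimage]
      exact hcont.closure_preimage_subset _
    have h2 := hψ.tsupport_subset (h1 hz)
    rw [coe_slab] at h2 ⊢
    exact mem_prod.2 ⟨(mem_prod.1 h2).1, mem_univ _⟩

omit [FiniteDimensional ℝ E] [MeasurableSpace E] [BorelSpace E] in
/-- Conjugated pull-back of vector test fields: `R⁻¹ ψ(s, R y)` is a test field on the slab. [folklore] -/
theorem isSpaceTimeTestOn_symm_conj {S : Set ℝ} (hS : IsOpen S) {ψ : ℝ → E → E}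
    (hψ : IsSpaceTimeTestOn (slab E S hS) ψ) (R : E ≃ₗᵢ[ℝ] E) :
    IsSpaceTimeTestOn (slab E S hS) (fun s y => R.symm (ψ s (R y))) := by
  have h1 := isSpaceTimeTestOn_comp_isometry hS hψ R
  have hrepr : uncurry (fun s y => R.symm (ψ s (R y))) = R.symm ∘ uncurry (fun s y => ψ s (R y)) := by
    funext z; rfl
  change IsTestFunctionOn _ (uncurry fun s y => R.symm (ψ s (R y)))
  rw [hrepr]
  refine ⟨R.symm.toContinuousLinearEquiv.contDiff.comp h1.contDiff, h1.hasCompactSupport.comp_left (map_zero _), ?_⟩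
  exact (closure_mono (support_comp_subset (map_zero _) _)).trans h1.tsupport_subset

/-- Local integrability on a slab is invariant under `(s, y) ↦ (s, R y)`. [folklore] -/
theorem locallyIntegrableOn_comp_prod_isometry {G : Type*} [NormedAddCommGroup G] (R : E ≃ₗᵢ[ℝ] E)
    {g : ℝ × E → G} {S : Set ℝ} (hg : LocallyIntegrableOn g (S ×ˢ (univ : Set E)) volume) :
    LocallyIntegrableOn (fun z : ℝ × E => g (z.1, R z.2)) (S ×ˢ (univ : Set E)) volume := by
  intro z hz
  have hz' : (z.1, R z.2) ∈ S ×ˢ (univ : Set E) := mem_prod.2 ⟨(mem_prod.1 hz).1, mem_univ _⟩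
  obtain ⟨U, hU, hgU⟩ := hg (z.1, R z.2) hz'
  refine ⟨(fun z : ℝ × E => (z.1, R z.2)) ⁻¹' U, ?_, ?_⟩
  · have hc : Continuous (fun z : ℝ × E => (z.1, R z.2)) :=
      continuous_fst.prodMk (R.continuous.comp continuous_snd)
    have h := hc.continuousWithinAt.preimage_mem_nhdsWithin'' hU rfl
    rwa [preimage_prod_isometry_slab] at h
  · exact ((measurePreserving_prod_isometry R).integrableOn_comp_preimage
      (measurableEmbedding_prod_isometry R)).2 hgU

/-- Post-composition with a continuous linear map preserves local integrability on a set. [folklore] -/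
theorem locallyIntegrableOn_clm_comp {X : Type*} [MeasurableSpace X] [TopologicalSpace X] {μ : Measure X}
    {G G' : Type*} [NormedAddCommGroup G] [NormedSpace ℝ G] [NormedAddCommGroup G'] [NormedSpace ℝ G']
    (L : G →L[ℝ] G') {g : X → G} {A : Set X} (hg : LocallyIntegrableOn g A μ) :
    LocallyIntegrableOn (fun x => L (g x)) A μ := by
  intro x hx
  obtain ⟨U, hU, hgU⟩ := hg x hx
  exact ⟨U, hU, L.integrable_comp hgU⟩

/-! ### Covariance of distributional solutions under linear isometries -/

/-- **DISTRIBUTIONAL NAVIER–STOKES / EULER SOLUTIONS ARE COVARIANT UNDER LINEAR ISOMETRIES.**  If `(u, p)` is a distributional (pressure-explicit,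
CKN (2.1)–(2.2)) solution with viscosity `ν` and force `f` on the slab `S × E` (`S` open), then for every linear isometry `R : E ≃ₗᵢ[ℝ] E` the conjugated
triple `(s, x) ↦ R (u s (R⁻¹ x))`, `(s, x) ↦ p s (R⁻¹ x)`, `(s, x) ↦ R (f s (R⁻¹ x))` is a distributional solution on the same slab with the same viscosity.
(Each test field `ψ` on the slab is answered by the identity for `ψ'(s, y) = R⁻¹ ψ(s, R y)` — resp. `θ'(s, y) = θ(s, R y)` for the divergence constraint —
after the measure-preserving change of variables `x = R y`; the weak twin of Majda–Bertozzi Prop. 1.1 (iii).)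
[cite: MajdaBertozziCUP2002, §1.2 Prop. 1.1 (iii)] -/
theorem isDistributional_conj_isometry {S : Set ℝ} (hS : IsOpen S) {ν : ℝ} {f u : ℝ → E → E} {p : ℝ → E → ℝ}
    (h : IsDistributionalNSSolutionOn (slab E S hS) ν f u p) (R : E ≃ₗᵢ[ℝ] E) :
    IsDistributionalNSSolutionOn (slab E S hS) ν (fun s x => R (f s (R.symm x))) (fun s x => R (u s (R.symm x)))
      (fun s x => p s (R.symm x)) := by
  obtain ⟨hu, hu2, hp, hdiv, hns⟩ := h
  rw [coe_slab] at hu hu2 hp hdiv hns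
  refine ⟨?_, ?_, ?_, ?_, ?_⟩
  · -- local integrability of the velocity
    rw [coe_slab]
    have h1 := locallyIntegrableOn_comp_prod_isometry R.symm hu
    exact locallyIntegrableOn_clm_comp (R : E →L[ℝ] E) h1
  · -- local integrability of `|u|²`
    rw [coe_slab]
    have h1 := locallyIntegrableOn_comp_prod_isometry R.symm hu2
    have heq : (fun z : ℝ × E => ‖uncurry (fun s x => R (u s (R.symm x))) z‖ ^ 2) =
        fun z : ℝ × E => ‖uncurry u (z.1, R.symm z.2)‖ ^ 2 := by
      funext z
      simp only [uncurry, LinearIsometryEquiv.norm_map]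
    rw [heq]
    exact h1
  · -- local integrability of the pressure
    rw [coe_slab]
    exact locallyIntegrableOn_comp_prod_isometry R.symm hp
  · -- weak divergence constraint
    intro θ hθ
    rw [coe_slab]
    set θ' : ℝ → E → ℝ := fun s y => θ s (R y) with hθ'
    have hθ'Q : IsSpaceTimeTestOn (slab E S hS) θ' := isSpaceTimeTestOn_comp_isometry hS hθ R
    set G : ℝ × E → ℝ := fun z' => ⟪u z'.1 z'.2, gradient (θ' z'.1) z'.2⟫ with hG
    have hzero : ∫ z in S ×ˢ (univ : Set E), G z = 0 := hdiv θ' hθ'Q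
    have key : ∀ z : ℝ × E, ⟪R (u z.1 (R.symm z.2)), gradient (θ z.1) z.2⟫ = G (z.1, R.symm z.2) := by
      intro z
      simp only [hG, hθ', gradient_comp_isometry, LinearIsometryEquiv.apply_symm_apply,
        LinearIsometryEquiv.inner_map_eq_flip]
    simp_rw [key]
    rw [setIntegral_slab_comp_prod_isometry R.symm S G, hzero]
  · -- momentum identity
    intro ψ hψ
    rw [coe_slab]
    set ψ' : ℝ → E → E := fun s y => R.symm (ψ s (R y)) with hψ'
    have hψ'Q : IsSpaceTimeTestOn (slab E S hS) ψ' := isSpaceTimeTestOn_symm_conj hS hψ R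
    set G : ℝ × E → ℝ := fun z' => ⟪u z'.1 z'.2, timeDeriv ψ' z'.1 z'.2⟫ +
        ⟪u z'.1 z'.2, convect (u z'.1) (ψ' z'.1) z'.2⟫ + ν * ⟪u z'.1 z'.2, Δ (ψ' z'.1) z'.2⟫ +
        p z'.1 z'.2 * VectorCalculus.divergence (ψ' z'.1) z'.2 + ⟪f z'.1 z'.2, ψ' z'.1 z'.2⟫ with hG
    have hzero : ∫ z in S ×ˢ (univ : Set E), G z = 0 := hns ψ' hψ'Q
    have key : ∀ z : ℝ × E,
        (⟪R (u z.1 (R.symm z.2)), timeDeriv ψ z.1 z.2⟫ +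
          ⟪R (u z.1 (R.symm z.2)), convect (fun x => R (u z.1 (R.symm x))) (ψ z.1) z.2⟫ +
          ν * ⟪R (u z.1 (R.symm z.2)), Δ (ψ z.1) z.2⟫ +
          p z.1 (R.symm z.2) * VectorCalculus.divergence (ψ z.1) z.2 +
          ⟪R (f z.1 (R.symm z.2)), ψ z.1 z.2⟫) = G (z.1, R.symm z.2) := by
      intro z
      simp only [hG, hψ', convect, timeDeriv_symm_conj, fderiv_symm_conj_apply, laplacian_symm_conj,
        divergence_symm_conj, LinearIsometryEquiv.apply_symm_apply, LinearIsometryEquiv.inner_map_eq_flip]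
    simp_rw [key]
    rw [setIntegral_slab_comp_prod_isometry R.symm S G, hzero]

end Covariance

/-! ### Isometry slaving: the class pressure inherits every linear isometry of the velocity (a.e.) -/

/-- The cylinder `Q_a(0) = (−a², 0) × B_a(0)` is invariant under `(s, x) ↦ (s, R x)`. [folklore] -/
theorem preimage_prod_isometry_parabolicCylinder (R : EuclideanSpace ℝ (Fin 3) ≃ₗᵢ[ℝ] EuclideanSpace ℝ (Fin 3)) (a : ℝ) :
    (fun z : ℝ × EuclideanSpace ℝ (Fin 3) => (z.1, R z.2)) ⁻¹' parabolicCylinder a (0 : ℝ × EuclideanSpace ℝ (Fin 3)) =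
      parabolicCylinder a (0 : ℝ × EuclideanSpace ℝ (Fin 3)) := by
  ext z
  simp only [mem_preimage, mem_parabolicCylinder, Prod.fst_zero, Prod.snd_zero, dist_zero_right, LinearIsometryEquiv.norm_map]

/-- **ISOMETRY SLAVING (weak class).**  `(u, p)` a distributional Euler pair (no force) on `(−∞,0) × ℝ³` with the `D`-type growth
`∫∫_{Q_a(0)}|p|^{3/2} ≤ K a^m` for `a ≥ a₀` (`K < ∞`, `m < 3`), `R` a linear isometry of `ℝ³` under which the velocity is EQUIVARIANT on the slab,
`u(s, R y) = R u(s, y)` (`s < 0`).  Then the pressure is `R`-INVARIANT a.e.: `p(s, R⁻¹ x) = p(s, x)` for a.e. `(s, x)` in the slab.  (The conjugated pair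
`(R u(s, R⁻¹·), p(s, R⁻¹·)) = (u, p ∘ R⁻¹)` is a second Euler pressure of the same velocity with the same growth — `Q_a(0)` is `R`-invariant — so
`pressure_ae_unique` applies.) [folklore; RusinSverak2011 §2 p. 4; KNSS2009 §1] -/
theorem pressure_comp_isometry_symm_ae_eq (R : EuclideanSpace ℝ (Fin 3) ≃ₗᵢ[ℝ] EuclideanSpace ℝ (Fin 3))
    {u : ℝ → EuclideanSpace ℝ (Fin 3) → EuclideanSpace ℝ (Fin 3)} {p : ℝ → EuclideanSpace ℝ (Fin 3) → ℝ}
    (hdist : IsDistributionalNSSolutionOn (slab (EuclideanSpace ℝ (Fin 3)) (Iio 0) isOpen_Iio) 0 0 u p)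
    {K : ENNReal} (hK : K ≠ ⊤) {m a₀ : ℝ} (hm : m < 3)
    (hD : ∀ a : ℝ, a₀ ≤ a →
      ∫⁻ z in parabolicCylinder a (0 : ℝ × EuclideanSpace ℝ (Fin 3)), ‖p z.1 z.2‖ₑ ^ (3 / 2 : ℝ) ≤ K * ENNReal.ofReal (a ^ m))
    (hfix : ∀ s : ℝ, s < 0 → ∀ y : EuclideanSpace ℝ (Fin 3), u s (R y) = R (u s y)) :
    ∀ᵐ z ∂(volume.restrict (Iio (0 : ℝ) ×ˢ (univ : Set (EuclideanSpace ℝ (Fin 3))))),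
      p z.1 (R.symm z.2) = p z.1 z.2 := by
  -- the conjugated pair has the same velocity on the slab
  have hconj := isDistributional_conj_isometry isOpen_Iio hdist R
  have hq : IsDistributionalNSSolutionOn (slab (EuclideanSpace ℝ (Fin 3)) (Iio 0) isOpen_Iio) 0 0 u
      (fun s x => p s (R.symm x)) := by
    have h0 : (fun s (x : EuclideanSpace ℝ (Fin 3)) => R ((0 : ℝ → EuclideanSpace ℝ (Fin 3) → EuclideanSpace ℝ (Fin 3)) s (R.symm x))) = 0 := by
      funext s x; simp
    rw [h0] at hconj
    refine hconj.congr_ae ?_ (ae_of_all _ fun _ => rfl)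
    rw [coe_slab]
    filter_upwards [ae_restrict_mem (measurableSet_Iio.prod MeasurableSet.univ)] with z hz
    simp only [uncurry]
    rw [← hfix z.1 (mem_prod.1 hz).1 (R.symm z.2), LinearIsometryEquiv.apply_symm_apply]
  -- the same growth
  have hDq : ∀ a : ℝ, a₀ ≤ a →
      ∫⁻ z in parabolicCylinder a (0 : ℝ × EuclideanSpace ℝ (Fin 3)), ‖p z.1 (R.symm z.2)‖ₑ ^ (3 / 2 : ℝ) ≤
        K * ENNReal.ofReal (a ^ m) := by
    intro a ha
    have h := (measurePreserving_prod_isometry R.symm).setLIntegral_comp_preimage_emb (measurableEmbedding_prod_isometry R.symm)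
      (fun z : ℝ × EuclideanSpace ℝ (Fin 3) => ‖p z.1 z.2‖ₑ ^ (3 / 2 : ℝ)) (parabolicCylinder a (0 : ℝ × EuclideanSpace ℝ (Fin 3)))
    rw [preimage_prod_isometry_parabolicCylinder] at h
    rw [h]
    exact hD a ha
  have h := pressure_ae_unique hq hdist hK hm hDq hD
  exact h

/-- The same, composed on the other side: `p(s, R y) = p(s, y)` for a.e. `(s, y)` in the slab. [folklore; KNSS2009 §1] -/
theorem pressure_comp_isometry_ae_eq (R : EuclideanSpace ℝ (Fin 3) ≃ₗᵢ[ℝ] EuclideanSpace ℝ (Fin 3))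
    {u : ℝ → EuclideanSpace ℝ (Fin 3) → EuclideanSpace ℝ (Fin 3)} {p : ℝ → EuclideanSpace ℝ (Fin 3) → ℝ}
    (hdist : IsDistributionalNSSolutionOn (slab (EuclideanSpace ℝ (Fin 3)) (Iio 0) isOpen_Iio) 0 0 u p)
    {K : ENNReal} (hK : K ≠ ⊤) {m a₀ : ℝ} (hm : m < 3)
    (hD : ∀ a : ℝ, a₀ ≤ a →
      ∫⁻ z in parabolicCylinder a (0 : ℝ × EuclideanSpace ℝ (Fin 3)), ‖p z.1 z.2‖ₑ ^ (3 / 2 : ℝ) ≤ K * ENNReal.ofReal (a ^ m))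
    (hfix : ∀ s : ℝ, s < 0 → ∀ y : EuclideanSpace ℝ (Fin 3), u s (R y) = R (u s y)) :
    ∀ᵐ z ∂(volume.restrict (Iio (0 : ℝ) ×ˢ (univ : Set (EuclideanSpace ℝ (Fin 3))))),
      p z.1 (R z.2) = p z.1 z.2 := by
  have hfix' : ∀ s : ℝ, s < 0 → ∀ y : EuclideanSpace ℝ (Fin 3), u s (R.symm y) = R.symm (u s y) := by
    intro s hs y
    have h1 := hfix s hs (R.symm y)
    rw [LinearIsometryEquiv.apply_symm_apply] at h1
    rw [h1, LinearIsometryEquiv.symm_apply_apply]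
  have h := pressure_comp_isometry_symm_ae_eq R.symm hdist hK hm hD hfix'
  simpa only [LinearIsometryEquiv.symm_symm] using h

/-- **MEMBER FORM (crux binders verbatim, every `ρ > −½`).**  A member of the crux class (`InClass ρ u p H c` unfolded: suitable weak Euler on
`(−∞,0) × ℝ³`, weak gradient `H`, gauge bound `a^{2ρ}A + a^{ρ}E + a^{2ρ}D ≤ c` for all `a > 0`) whose velocity slices are equivariant under a linear isometry
`R` of `ℝ³` for `τ < 0` has `R`-invariant pressure a.e. on the slab.  (The `D`-gauge gives the growth `∫∫_{Q_a(0)}|p|^{3/2} ≤ c a^{2−2ρ}`,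
`2 − 2ρ < 3`.) [folklore; KNSS2009 §1] -/
theorem pressure_comp_isometry_ae_eq_of_gauge {ρ : ℝ} (hρ : -1 / 2 < ρ)
    {u : ℝ → EuclideanSpace ℝ (Fin 3) → EuclideanSpace ℝ (Fin 3)} {p : ℝ → EuclideanSpace ℝ (Fin 3) → ℝ}
    {H : ℝ → EuclideanSpace ℝ (Fin 3) → EuclideanSpace ℝ (Fin 3) →L[ℝ] EuclideanSpace ℝ (Fin 3)} {c : ℝ≥0}
    (hsw : IsSuitableWeakSolutionOn (slab (EuclideanSpace ℝ (Fin 3)) (Iio 0) isOpen_Iio) 0 0 u p)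
    (_hH : HasWeakSpatialGradientOn (slab (EuclideanSpace ℝ (Fin 3)) (Iio 0) isOpen_Iio) u H)
    (hgauge : ∀ a : ℝ, 0 < a →
      ENNReal.ofReal (a ^ (2 * ρ)) * cknA a (0 : ℝ × EuclideanSpace ℝ (Fin 3)) u +
          ENNReal.ofReal (a ^ ρ) * cknE a (0 : ℝ × EuclideanSpace ℝ (Fin 3)) H +
        ENNReal.ofReal (a ^ (2 * ρ)) * cknD a (0 : ℝ × EuclideanSpace ℝ (Fin 3)) p ≤ (c : ENNReal))
    (R : EuclideanSpace ℝ (Fin 3) ≃ₗᵢ[ℝ] EuclideanSpace ℝ (Fin 3))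
    (hfix : ∀ τ : ℝ, τ < 0 → ∀ y : EuclideanSpace ℝ (Fin 3), u τ (R y) = R (u τ y)) :
    ∀ᵐ z ∂(volume.restrict (Iio (0 : ℝ) ×ˢ (univ : Set (EuclideanSpace ℝ (Fin 3))))),
      p z.1 (R z.2) = p z.1 z.2 := by
  have hcD : ∀ a : ℝ, 0 < a →
      ENNReal.ofReal (a ^ (2 * ρ)) * cknD a (0 : ℝ × EuclideanSpace ℝ (Fin 3)) p ≤ (c : ENNReal) :=
    fun a ha => le_trans le_add_self (hgauge a ha)
  have hD : ∀ a : ℝ, 1 ≤ a →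
      ∫⁻ z in parabolicCylinder a (0 : ℝ × EuclideanSpace ℝ (Fin 3)), ‖p z.1 z.2‖ₑ ^ (3 / 2 : ℝ) ≤
        (c : ENNReal) * ENNReal.ofReal (a ^ (2 - 2 * ρ)) :=
    fun a ha => lintegral_cylinder_le_of_gaugeD hcD (one_pos.trans_le ha)
  exact pressure_comp_isometry_ae_eq R hsw.distributional ENNReal.coe_ne_top (m := 2 - 2 * ρ) (by linarith) hD hfix

/-- **AXISYMMETRIC VELOCITY ⇒ AXISYMMETRIC PRESSURE (a.e., weak class, no hypothesis on `p`).**  A member of the crux class (every `ρ > −½`) whose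
velocity slices are axisymmetric for `τ < 0` has, for every angle `θ`, `p(s, R_θ y) = p(s, y)` for a.e. `(s, y)` in the slab. [cite: KNSS2009, §1] -/
theorem pressure_rotZ_ae_eq_of_gauge {ρ : ℝ} (hρ : -1 / 2 < ρ)
    {u : ℝ → EuclideanSpace ℝ (Fin 3) → EuclideanSpace ℝ (Fin 3)} {p : ℝ → EuclideanSpace ℝ (Fin 3) → ℝ}
    {H : ℝ → EuclideanSpace ℝ (Fin 3) → EuclideanSpace ℝ (Fin 3) →L[ℝ] EuclideanSpace ℝ (Fin 3)} {c : ℝ≥0}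
    (hsw : IsSuitableWeakSolutionOn (slab (EuclideanSpace ℝ (Fin 3)) (Iio 0) isOpen_Iio) 0 0 u p)
    (hH : HasWeakSpatialGradientOn (slab (EuclideanSpace ℝ (Fin 3)) (Iio 0) isOpen_Iio) u H)
    (hgauge : ∀ a : ℝ, 0 < a →
      ENNReal.ofReal (a ^ (2 * ρ)) * cknA a (0 : ℝ × EuclideanSpace ℝ (Fin 3)) u +
          ENNReal.ofReal (a ^ ρ) * cknE a (0 : ℝ × EuclideanSpace ℝ (Fin 3)) H +
        ENNReal.ofReal (a ^ (2 * ρ)) * cknD a (0 : ℝ × EuclideanSpace ℝ (Fin 3)) p ≤ (c : ENNReal))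
    (hax : ∀ τ : ℝ, τ < 0 → IsAxisymmetric (u τ)) (θ : ℝ) :
    ∀ᵐ z ∂(volume.restrict (Iio (0 : ℝ) ×ˢ (univ : Set (EuclideanSpace ℝ (Fin 3))))),
      p z.1 (rotZ θ z.2) = p z.1 z.2 := by
  have hfix : ∀ τ : ℝ, τ < 0 → ∀ y : EuclideanSpace ℝ (Fin 3), u τ (rotZLIE θ y) = rotZLIE θ (u τ y) :=
    fun τ hτ y => by simpa only [rotZLIE_apply] using hax τ hτ θ y
  simpa only [rotZLIE_apply] using pressure_comp_isometry_ae_eq_of_gauge hρ hsw hH hgauge (rotZLIE θ) hfix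

end PressureSlaving

end Summit.NavierStokesRegularity.NavierStokesRegularity.Theorems.PowerGaugeEulerLiouville

end
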